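import Summits.CriticalPhenomena.PercolationContinuityZ3.Theorems.Transplant.AutChartTreeChartCylinders
import Summits.CriticalPhenomena.PercolationContinuityZ3.Theorems.Transplant.PlanarSkeletonFrmQuasiDefs
import HarnessLib

/-!
# The TREE CHART of an action with finitely many orbits, V: THE ADAPTER `TreeDatum ↦ PlanarSkeletonFrmQuasi` (the quasi-step carrier of the (N3-b) rung,
# design owner's «PlanarSkeletonFrmQuasiDefs» p507026) and the PROXIES of its residue types

builds on p205010 (kernel theorem, internal audit signed; external expert review pending) — nothing in this file uses p205010 and nothing here is a
percolation statement or a claim about any node (the hC-node over `PlanarSkeletonFrmQuasi` is the planners'/lead's and is NOT declared here).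
Lane `prim-bschramm`, seat `prim-bschramm-p5` gen 28 (refuter / sharpness seat; adapter assigned by the design owner, lane INBOX 2026-08-27 06:53Z).
Helper file (`--supports stmt-CriticalPhenomena-4575 --as helper`): ONE definition (`TreeDatum.skeleton`) + its field lemmas + the proxy lemma.

WHAT.  For a tree datum `D` on a connected locally finite graph whose character has its kernel generated by bounded movers (Milnor off exponential
growth, `TreeDatum.exists_ker_gen`), **`D.skeleton hc hker : PlanarSkeletonFrmQuasi G`** with: `φ := D.coarse` (1-Lipschitz, `coarse_lip`), `types := the
residue transversal` (`exists_coarseFrames`), `frame`, `Δ := max degree over reps` (`degree_le_sup`: every vertex is a translate of a representative),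
`M := (R+1)·|reps|`, `qstep := coarse_qStepsN` (EXACT footprint), `ℓ₀ := 0`, `W` and `cyl_reach` from `coarse_cyl_reach` (IV).  So every action with
finitely many orbits and a rank-two character killing a stabiliser, on a connected locally finite graph without exponential growth, carries the quasi-step
carrier (`exists_skeleton`).  §3 supplies what the node asks PER TYPE — proxies (the `HasProxies` shape of «PlanarSkeletonFrmFromProxies», stated here
chart-wise for the coarse tree chart; the `PlanarSkeletonFrmQuasi.HasProxies` wrapper is the (c3) row's): for every base `t` and every vertex `c` an
`A`-translate `g • t` with the coarse value of `c`, `g` translating the coarse chart EXACTLY, within UNIFORM graph distance of `c` (`exists_coarse_proxies`;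
no Milnor needed: the value to hit lies in `N ℤ² ⊆ c(A)` by the axis edges, the correction has sup-norm `≤ N`, small movers do the rest).
[cite: KozmaNitzan2024, §4 p. 15 (boxes), p. 16 (Lemma 8), p. 19 (Step III)] [cite: MartineauTassion2017, §3.2] [cite: BenjaminiSchramm1996, §2]
[cite: MilnorSolvableGrowth1968, Lemma 1]
-/

noncomputable section

namespace Summit.CriticalPhenomena.PercolationContinuityZ3.Theorems.Transplant

open SimpleGraph Literature.Barriers.CriticalPhenomena Literature.Probability.LatticeModels Literature.Probability.Percolation
open scoped Classical

namespace AutChart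

namespace TreeDatum

variable {V : Type} {G : SimpleGraph V} {A : Type} [Group A] [MulAction A V] (D : TreeDatum G A) [G.LocallyFinite]

/-! ## §1 The remaining fields: degree bound and residue types -/

/-- **Degrees are bounded by the largest degree of a representative** (every vertex is a translate of a representative by an automorphism). [folklore] -/
theorem degree_le_sup (w : V) : G.degree w ≤ D.reps.sup fun r => G.degree r := by
  obtain ⟨a, r, hr, rfl⟩ := D.cover w
  have h : G.degree (a • r) = G.degree r := by rw [← smulIso_apply D.act a r, Iso.degree_eq]
  rw [h]
  exact Finset.le_sup (f := fun r => G.degree r) hr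

/-- **The residue types** of the coarse chart (a chosen finite set of frame types). [this work] -/
def coarseTypes : Finset V := Classical.choose D.exists_coarseFrames

/-- The residue types carry translating frames for the coarse chart. [folklore] -/
theorem frames_coarseTypes : Skelφ.Frames G D.coarse D.coarseTypes := Classical.choose_spec D.exists_coarseFrames

/-! ## §2 The carrier -/

/-- **THE QUASI-STEP CARRIER OF A TREE DATUM**: `PlanarSkeletonFrmQuasi G` with the coarse tree chart, its residue types and frames, the representatives'
degree bound, EXACT-FOOTPRINT quasi-steps of cost `(R+1)|reps|`, and cylinders joined inside their `W`-fattening from width `0` on (kernel generated by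
movers of displacement `≤ m`). [cite: KozmaNitzan2024, §4 p. 16 (Lemma 8), p. 19 (Step III)] -/
def skeleton (hc : G.Connected) {m : ℕ}
    (hker : ∀ r ∈ D.reps, ∀ k : A, D.c k = 1 → k ∈ Subgroup.closure {g : A | D.c g = 1 ∧ g • r ∈ graphBall G r m}) :
    PlanarSkeletonFrmQuasi G where
  φ := D.coarse
  lip := D.coarse_lip
  types := D.coarseTypes
  frame := D.frames_coarseTypes
  Δ := D.reps.sup fun r => G.degree r
  degree_le := D.degree_le_sup
  M := (D.R + 1) * D.reps.card
  qstep := D.coarse_qStepsN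
  ℓ₀ := 0
  W := Classical.choose (D.coarse_cyl_reach hc hker)
  cyl_reach := fun t _ ℓ _ u v hu hv => Classical.choose_spec (D.coarse_cyl_reach hc hker) t ℓ u v hu hv

section Fields

variable (hc : G.Connected) {m : ℕ} (hker : ∀ r ∈ D.reps, ∀ k : A, D.c k = 1 → k ∈ Subgroup.closure {g : A | D.c g = 1 ∧ g • r ∈ graphBall G r m})

/-- The carrier's chart is the coarse tree chart. [folklore] -/
@[simp] theorem skeleton_φ : (D.skeleton hc hker).φ = D.coarse := rfl

/-- The carrier's types are the residue types. [folklore] -/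
@[simp] theorem skeleton_types : (D.skeleton hc hker).types = D.coarseTypes := rfl

/-- The carrier's quasi-step cost. [folklore] -/
@[simp] theorem skeleton_M : (D.skeleton hc hker).M = (D.R + 1) * D.reps.card := rfl

/-- The carrier's cylinders are connected inside their fattening from width `0` on. [folklore] -/
@[simp] theorem skeleton_ℓ₀ : (D.skeleton hc hker).ℓ₀ = 0 := rfl

/-- The carrier's cylinders are the coarse boxes. [folklore] -/
theorem skeleton_cyl (t : V) (ℓ : ℕ) : (D.skeleton hc hker).cyl t ℓ = {w | D.coarse w - D.coarse t ∈ box 2 ℓ} := rfl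

end Fields

/-- **EVERY FINITE-ORBIT ACTION WITH A RANK-TWO CHARACTER CARRIES THE QUASI-STEP CARRIER off exponential growth**: tree datum (`exists_treeDatum`), kernel
generated by bounded movers (`exists_ker_gen`), adapter `skeleton`.  (On exponential growth the node's conclusion is Hutchcroft's theorem and no carrier is
needed.) [cite: BenjaminiSchramm1996, §2 (almost transitive graphs)] [cite: MilnorSolvableGrowth1968, Lemma 1] [cite: Hutchcroft2016, Thm. 1.1] -/
theorem exists_skeleton (hact : IsActionByAut G A) (hc : G.Connected) (reps₀ : Finset V)
    (hcover₀ : ∀ w : V, ∃ a : A, ∃ r ∈ reps₀, a • r = w) (c : A →* Multiplicative (Site 2)) {t : V}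
    (hstab : ∀ h ∈ MulAction.stabilizer A t, c h = 1)
    (hrank : ∃ a b : A, MaxArea.det2 (Multiplicative.toAdd (c a)) (Multiplicative.toAdd (c b)) ≠ 0) (hG : ¬ HasExponentialGrowth G) :
    ∃ (D : TreeDatum G A) (m : ℕ) (hker : ∀ r ∈ D.reps, ∀ k : A, D.c k = 1 → k ∈ Subgroup.closure {g : A | D.c g = 1 ∧ g • r ∈ graphBall G r m})
      (u w : Site 2), D.c = (rebaseHom u w).comp c ∧ (D.skeleton hc hker).φ = D.coarse := by
  obtain ⟨D, u, w, hc', -⟩ := exists_treeDatum hact hc reps₀ hcover₀ c hstab hrank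
  obtain ⟨m, hker⟩ := D.exists_ker_gen hc hG
  exact ⟨D, m, hker, u, w, hc', rfl⟩

/-! ## §3 Proxies of the residue types -/

/-- **Small movers, graph-distance form**: uniformly in `r ∈ reps` and in the value (sup-norm `≤ N`), an element of the same value moving `r` within graph
distance `L`. [folklore] -/
theorem exists_small_movers_ball (hc : G.Connected) :
    ∃ L : ℕ, ∀ r ∈ D.reps, ∀ a : A, (∀ j : Fin 2, |Multiplicative.toAdd (D.c a) j| ≤ D.N) →
      ∃ b : A, D.c b = D.c a ∧ b • r ∈ graphBall G r L := by
  have hw : ∀ (r : V) (a : A), ∃ n : ℕ, a • r ∈ graphBall G r n := fun r a => by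
    obtain ⟨w⟩ := hc.preconnected r (a • r)
    exact ⟨w.length, w, le_rfl⟩
  choose len hlen using hw
  let pick : Site 2 → A := fun y => if h : ∃ a : A, Multiplicative.toAdd (D.c a) = y then Classical.choose h else 1
  refine ⟨D.reps.sup fun r => (box 2 D.N).sup fun y => len r (pick y), fun r hr a ha => ?_⟩
  set y : Site 2 := Multiplicative.toAdd (D.c a) with hy
  have hyY : y ∈ box 2 D.N := by rw [mem_box]; intro j; exact abs_le.1 (ha j)
  have hex : ∃ a' : A, Multiplicative.toAdd (D.c a') = y := ⟨a, rfl⟩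
  have hpick : Multiplicative.toAdd (D.c (pick y)) = y := by
    simp only [pick, dif_pos hex]
    exact Classical.choose_spec hex
  refine ⟨pick y, Multiplicative.toAdd.injective (by rw [hpick]), graphBall_mono G r ?_ (hlen r (pick y))⟩
  exact le_trans (Finset.le_sup (f := fun y => len r (pick y)) hyY) (Finset.le_sup (f := fun r => (box 2 D.N).sup fun y => len r (pick y)) hr)

omit [G.LocallyFinite] in
/-- **Every value of `Δ ℤ²` is attained** by a product of powers of the two axis movers. [folklore] -/
theorem exists_toAdd_eq_of_dvd (z : Site 2) (hz : ∀ j : Fin 2, (D.Δ : ℤ) ∣ z j) : ∃ g : A, Multiplicative.toAdd (D.c g) = z := by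
  obtain ⟨r₀, -, n₀, -, hn₀⟩ := D.axis 0 1
  obtain ⟨r₁, -, n₁, -, hn₁⟩ := D.axis 1 1
  -- the axis movers: the sections of the axis neighbours
  have h0 : Multiplicative.toAdd (D.c (osec D.cover n₀)) = Pi.single 0 (D.Δ : ℤ) := by
    have e : ochart D.cover D.c n₀ = Multiplicative.toAdd (D.c (osec D.cover n₀)) := rfl
    rw [← e, hn₀, Units.val_one, mul_one]
  have h1 : Multiplicative.toAdd (D.c (osec D.cover n₁)) = Pi.single 1 (D.Δ : ℤ) := by
    have e : ochart D.cover D.c n₁ = Multiplicative.toAdd (D.c (osec D.cover n₁)) := rfl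
    rw [← e, hn₁, Units.val_one, mul_one]
  obtain ⟨k₀, hk₀⟩ := hz 0
  obtain ⟨k₁, hk₁⟩ := hz 1
  refine ⟨osec D.cover n₀ ^ k₀ * osec D.cover n₁ ^ k₁, ?_⟩
  rw [map_mul, toAdd_mul, map_zpow, toAdd_zpow, map_zpow, toAdd_zpow, h0, h1]
  funext j
  fin_cases j
  · simp [hk₀, mul_comm]
  · simp [hk₁, mul_comm]

/-- **PROXIES OF THE COARSE TREE CHART**: there is a radius `Dp` such that for every vertex `t` and every vertex `c` some translate `g • t` has the coarse value
of `c`, `g` translates the coarse chart EXACTLY, and `c` lies within graph distance `Dp` of `g • t` — the `HasProxies t Dp` shape of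
«PlanarSkeletonFrmFromProxies» for the carrier `D.skeleton`, at EVERY `t`.  (Value to hit: `N (coarse c − coarse t) ∈ N ℤ² ⊆ Δ ℤ²`; the correction
`N(coarse c − coarse t) + chart t − chart c` has sup-norm `≤ N`, so a small mover of that value at the type of `t` places the proxy.) [this work] -/
theorem exists_coarse_proxies (hc : G.Connected) :
    ∃ Dp : ℕ, ∀ t c : V, ∃ (c' : V) (g : A), g • t = c' ∧ (∀ w : V, D.coarse (g • w) = D.coarse w + (D.coarse c' - D.coarse t)) ∧
      D.coarse c' = D.coarse c ∧ c ∈ graphBall G c' Dp := by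
  obtain ⟨L, hL⟩ := D.exists_small_movers_ball hc
  have hN := D.N_pos
  -- a bound for the tree walks
  refine ⟨L + D.reps.card, fun t c => ?_⟩
  obtain ⟨bt, rt, hrt, htq⟩ := D.cover t
  obtain ⟨b, r, hr, hcq⟩ := D.cover c
  -- the value to hit and the correction
  set z : Site 2 := fun j => (D.N : ℤ) * (D.coarse c j - D.coarse t j) with hz
  have hzj : ∀ j : Fin 2, z j = (D.N : ℤ) * (D.coarse c j - D.coarse t j) := fun j => rfl
  have hNΔ : (D.N : ℤ) = (D.Δ : ℤ) * ((D.R : ℤ) + 1) := by simp only [TreeDatum.N, Nat.cast_mul, Nat.cast_add, Nat.cast_one]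
  have hzdvd : ∀ j : Fin 2, (D.Δ : ℤ) ∣ z j := fun j => by
    rw [hzj j, hNΔ]
    exact Dvd.dvd.mul_right (Dvd.intro _ rfl) _
  obtain ⟨gz, hgz⟩ := D.exists_toAdd_eq_of_dvd z hzdvd
  have hct : D.chart t = Multiplicative.toAdd (D.c bt) := by rw [← htq, D.chart_smul, D.chart_of_mem hrt, add_zero]
  have hcc : D.chart c = Multiplicative.toAdd (D.c b) := by rw [← hcq, D.chart_smul, D.chart_of_mem hr, add_zero]
  -- the correction element `b⁻¹ gz bt` has sup-norm value `≤ N`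
  set a : A := b⁻¹ * gz * bt with ha
  have haval : ∀ j : Fin 2, |Multiplicative.toAdd (D.c a) j| ≤ D.N := fun j => by
    rw [ha, map_mul, toAdd_mul, map_mul, toAdd_mul, map_inv, toAdd_inv, hgz, Pi.add_apply, Pi.add_apply, Pi.neg_apply, ← hcc, ← hct, hzj j,
      D.coarse_apply, D.coarse_apply]
    have hc1 := Int.emod_add_mul_ediv (D.chart c j) D.N
    have hc2 := Int.emod_nonneg (D.chart c j) hN.ne'
    have hc3 := Int.emod_lt_of_pos (D.chart c j) hN
    have ht1 := Int.emod_add_mul_ediv (D.chart t j) D.N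
    have ht2 := Int.emod_nonneg (D.chart t j) hN.ne'
    have ht3 := Int.emod_lt_of_pos (D.chart t j) hN
    rw [abs_le]
    generalize D.chart c j / (D.N : ℤ) = qc at hc1 ⊢
    generalize D.chart t j / (D.N : ℤ) = qt at ht1 ⊢
    generalize D.chart c j % (D.N : ℤ) = rc at hc1 hc2 hc3
    generalize D.chart t j % (D.N : ℤ) = rt' at ht1 ht2 ht3
    constructor <;> nlinarith
  -- a small mover `b'` of that value at the type of `t`, within distance `L`
  obtain ⟨b', hb', hball⟩ := hL rt hrt a haval
  set g : A := b * b' * bt⁻¹ with hg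
  have hgt : g • t = (b * b') • rt := by rw [hg, ← htq, ← mul_smul, inv_mul_cancel_right]
  have hgval : Multiplicative.toAdd (D.c g) = z := by
    have e : Multiplicative.toAdd (D.c b') = Multiplicative.toAdd (D.c a) := by rw [hb']
    rw [hg, map_mul, toAdd_mul, map_mul, toAdd_mul, map_inv, toAdd_inv, e, ha, map_mul, toAdd_mul, map_mul, toAdd_mul, map_inv, toAdd_inv, hgz]
    abel
  have hgdvd : ∀ j : Fin 2, (D.N : ℤ) ∣ Multiplicative.toAdd (D.c g) j := fun j => by rw [hgval, hzj j]; exact Dvd.intro _ rfl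
  have htrans : ∀ w : V, D.coarse (g • w) = D.coarse w + (D.coarse c - D.coarse t) := fun w => by
    rw [D.coarse_smul_of_dvd g hgdvd]
    congr 1
    funext j
    rw [hgval, hzj j, Pi.sub_apply]
    exact Int.mul_ediv_cancel_left _ hN.ne'
  have hgt_coarse : D.coarse (g • t) = D.coarse c := by
    rw [htrans t]
    funext j
    rw [Pi.add_apply, Pi.sub_apply]
    ring
  refine ⟨g • t, g, rfl, fun w => ?_, hgt_coarse, ?_⟩
  · rw [htrans w, hgt_coarse]
  · -- distance: `c = b • r`, `g • t = b • (b' • rt)`; `r → rt` is a tree walk, `rt → b' • rt` has length `≤ L`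
    rw [hgt, mul_smul, ← hcq]
    refine (smul_mem_graphBall_iff D.act b).2 ?_
    obtain ⟨q, hql, -⟩ := D.exists_repPath hrt hr
    obtain ⟨p, hp⟩ := hball
    refine ⟨p.reverse.append q, ?_⟩
    rw [Walk.length_append, Walk.length_reverse]
    omega

end TreeDatum

end AutChart

end Summit.CriticalPhenomena.PercolationContinuityZ3.Theorems.Transplant

end
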